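import Mathlib.Analysis.Fourier.FourierTransform
import Mathlib.MeasureTheory.Measure.Lebesgue.EqHaar
import Mathlib.MeasureTheory.Group.Integral
import Mathlib.Analysis.SpecialFunctions.Trigonometric.Bounds
import Mathlib.Analysis.Real.Pi.Bounds
import HarnessLib

/-!
# Bounded Fourier transform of doubly truncated Calderón–Zygmund kernels (Grafakos, CFA, Thm. 5.4.1)

Topic `Literature/Analysis/SingularIntegrals` (trunk T-SOBOLEV / harmonic analysis). Theorems only.

**Grafakos, *Classical Fourier Analysis* (3rd ed. 2014), Thm. 5.4.1, estimate (5.4.4).** Let `K` be locally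
integrable on `ℝⁿ ∖ {0}` and satisfy the size condition (5.4.1) `∫_{R ≤ |x| ≤ 2R} |K| ≤ A₁`, Hörmander's smoothness
condition (5.4.2) `∫_{|x| ≥ 2|y|} |K(x − y) − K(x)| dx ≤ A₂` and the cancellation condition (5.4.3)
`|∫_{R₁ < |x| < R₂} K| ≤ A₃`. Then `sup_{0<ε<N<∞} sup_ξ |(K χ_{ε<|·|<N})^∧(ξ)| ≤ 15 (A₁ + A₂ + A₃)`
(`norm_setIntegral_annulus_cexp_mul_le`, `norm_fourier_indicator_annulus_le`). Consequently (by Plancherel) the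
truncated singular integrals `f ↦ f ∗ K χ_{ε<|·|<N}` are bounded on `L²` uniformly in the truncation — the `L²`
input that the Calderón–Zygmund `L^p` theory of this directory (`CalderonZygmundWeakType`, `CalderonZygmundLp`)
takes as a hypothesis.

Proof as printed (pp. 359–361 of the held copy), on a finite-dimensional real inner product space `V` with its
Haar volume: for `|ξ| N ≤ 1` write `e^{−2πix·ξ} = 1 + (e^{−2πix·ξ} − 1)` and use (5.4.3) plus
`|e^{−2πix·ξ} − 1| ≤ 2π|x||ξ|` with the dyadic bound `∫_{ε<|x|<r} |x||K| ≤ 2A₁ r` (`setIntegral_norm_mul_norm_le`,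
`norm_setIntegral_annulus_le_of_small`); for the part `|ξ|⁻¹ < |x| < N` translate by `z = ξ/(2|ξ|²)`
(`e^{2πi z·ξ} = −1`), average, and split into the Hörmander term and four shell terms
(`norm_setIntegral_annulus_le_of_inv_norm_le`: `≤ A₂/2 + 2A₁`); the three cases `ε < |ξ|⁻¹ < N`, `N ≤ |ξ|⁻¹`,
`|ξ|⁻¹ ≤ ε` are assembled in `norm_setIntegral_annulus_cexp_mul_le` (spheres are null, `setIntegral_annulus_split`).

Rendering: annuli are `ball 0 b \ closedBall 0 a` (open) and `closedBall 0 b \ ball 0 a` (closed shells); the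
standing qualitative hypothesis is integrability of `K` on closed shells away from `0`; (5.4.2) is required on the
bounded parts `{2|y| ≤ |x| ≤ N}` of Hörmander's region (equivalent for the printed statement, and what the proof
uses); `V` is assumed nontrivial only to make `A₂ ≥ 0` automatic.

Written as the first step of the `L²` theory needed for the mapping property (S3) of the Bogovskiĭ-type operator of
Mao–Oh–Tao (arXiv:2308.13031, Lemma 2.3) in `Literature/Geometry/Lorentzian/Bogovskii*.lean`.

## References

* L. Grafakos, *Classical Fourier Analysis*, 3rd ed., GTM 249, Springer 2014, §5.4.1, Thm. 5.4.1, (5.4.4)–(5.4.12)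
  (key `Grafakos2014`; held: `book:grafakos2014-classical-fourier-analysis`, PDF pp. 359–361).
* E. M. Stein, *Singular Integrals and Differentiability Properties of Functions*, Princeton 1970, Ch. II §3.
-/

noncomputable section

open MeasureTheory Metric Set Filter Complex
open scoped Real Topology RealInnerProductSpace FourierTransform

namespace Literature.Analysis.SingularIntegrals

variable {V : Type*} [NormedAddCommGroup V] [InnerProductSpace ℝ V] [FiniteDimensional ℝ V]
  [MeasurableSpace V] [BorelSpace V]

section TruncatedKernel

variable {K : V → ℂ} {A₁ A₂ A₃ : ℝ} {ξ : V}


omit [InnerProductSpace ℝ V] [FiniteDimensional ℝ V] [MeasurableSpace V] [BorelSpace V] in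
/-- Membership in the open annulus `{a < |x| < b} = B(0,b) ∖ B̄(0,a)`. [folklore] -/
theorem mem_ball_diff_closedBall_iff {a b : ℝ} {x : V} :
    x ∈ ball (0 : V) b \ closedBall 0 a ↔ a < ‖x‖ ∧ ‖x‖ < b := by
  simp only [Set.mem_sdiff, mem_ball, dist_zero_right, mem_closedBall, not_le]
  exact and_comm

omit [InnerProductSpace ℝ V] [FiniteDimensional ℝ V] [MeasurableSpace V] [BorelSpace V] in
/-- Membership in the closed shell `{a ≤ |x| ≤ b} = B̄(0,b) ∖ B(0,a)`. [folklore] -/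
theorem mem_closedBall_diff_ball_iff {a b : ℝ} {x : V} :
    x ∈ closedBall (0 : V) b \ ball 0 a ↔ a ≤ ‖x‖ ∧ ‖x‖ ≤ b := by
  simp only [Set.mem_sdiff, mem_closedBall, dist_zero_right, mem_ball, not_lt]
  exact and_comm

omit [FiniteDimensional ℝ V] [MeasurableSpace V] [BorelSpace V] in
/-- The character `e_ξ(x) = e^{−2πi x·ξ}` has modulus one. [folklore] -/
theorem norm_cexp_neg_two_pi_inner_mul_I (x ξ : V) : ‖cexp (↑(-2 * π * ⟪x, ξ⟫) * I)‖ = 1 :=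
  norm_exp_ofReal_mul_I _

omit [FiniteDimensional ℝ V] [MeasurableSpace V] [BorelSpace V] in
/-- `|e^{−2πi x·ξ} − 1| ≤ 2π |x| |ξ|`. [folklore] -/
theorem norm_cexp_neg_two_pi_inner_mul_I_sub_one_le (x ξ : V) :
    ‖cexp (↑(-2 * π * ⟪x, ξ⟫) * I) - 1‖ ≤ 2 * π * ‖x‖ * ‖ξ‖ := by
  rw [mul_comm _ I]
  refine Real.norm_exp_I_mul_ofReal_sub_one_le.trans ?_
  rw [Real.norm_eq_abs, neg_mul, neg_mul, abs_neg, abs_mul, abs_mul, abs_of_pos two_pos, abs_of_pos Real.pi_pos]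
  calc 2 * π * |⟪x, ξ⟫| ≤ 2 * π * (‖x‖ * ‖ξ‖) := by gcongr; exact abs_real_inner_le_norm x ξ
    _ = 2 * π * ‖x‖ * ‖ξ‖ := by ring

omit [InnerProductSpace ℝ V] [FiniteDimensional ℝ V] [MeasurableSpace V] [BorelSpace V] in
/-- Membership in the half-open shell `{a ≤ |x| < b} = B(0,b) ∖ B(0,a)`. [folklore] -/
theorem mem_ball_diff_ball_iff {a b : ℝ} {x : V} :
    x ∈ ball (0 : V) b \ ball 0 a ↔ a ≤ ‖x‖ ∧ ‖x‖ < b := by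
  simp only [Set.mem_sdiff, mem_ball, dist_zero_right, not_lt]
  exact and_comm

/-- Integrability of `|x| |K(x)|` on measurable subsets of closed shells away from the origin. [folklore] -/
theorem integrableOn_norm_mul_norm (hK : ∀ a b, 0 < a → IntegrableOn K (closedBall (0 : V) b \ ball 0 a))
    {a b : ℝ} (ha : 0 < a) {S : Set V} (hS : S ⊆ closedBall 0 b \ ball 0 a) (hSm : MeasurableSet S) :
    IntegrableOn (fun x ↦ ‖x‖ * ‖K x‖) S := by
  have hb' : IntegrableOn (fun x ↦ |b| * ‖K x‖) (closedBall (0 : V) b \ ball 0 a) := (hK a b ha).norm.const_mul |b|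
  have hb : IntegrableOn (fun x ↦ |b| * ‖K x‖) S := hb'.mono_set hS
  refine Integrable.mono' hb ?_ ?_
  · exact (continuous_norm.aestronglyMeasurable.mul ((hK a b ha).mono_set hS).aestronglyMeasurable.norm)
  · refine (ae_restrict_iff' hSm).2 (ae_of_all _ fun x hx ↦ ?_)
    have hx' := hS hx
    rw [mem_closedBall_diff_ball_iff] at hx'
    rw [Real.norm_eq_abs, abs_of_nonneg (by positivity)]
    exact mul_le_mul_of_nonneg_right (hx'.2.trans (le_abs_self b)) (norm_nonneg _)

/-- **Dyadic moment bound.** Under the size condition `∫_{R ≤ |x| ≤ 2R} |K| ≤ A₁` one has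
`∫_{r/2^m < |x| < r} |x| |K(x)| dx ≤ 2 A₁ r (1 − 2^{−m})`. [cite: Grafakos2014, proof of Thm. 5.4.1] -/
theorem setIntegral_norm_mul_norm_le_dyadic (hK : ∀ a b, 0 < a → IntegrableOn K (closedBall (0 : V) b \ ball 0 a))
    (h1 : ∀ R, 0 < R → ∫ x in closedBall (0 : V) (2 * R) \ ball 0 R, ‖K x‖ ≤ A₁) (m : ℕ) {r : ℝ} (hr : 0 < r) :
    ∫ x in ball (0 : V) r \ closedBall 0 (r / 2 ^ m), ‖x‖ * ‖K x‖ ≤ 2 * A₁ * r * (1 - (2 ^ m : ℝ)⁻¹) := by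
  induction m generalizing r with
  | zero =>
    have he : ball (0 : V) r \ closedBall 0 r = ∅ := by
      ext x
      simp only [mem_ball_diff_closedBall_iff, mem_empty_iff_false, iff_false, not_and, not_lt]
      exact fun h ↦ h.le
    simp only [pow_zero, div_one, he, Measure.restrict_empty, integral_zero_measure, inv_one, sub_self, mul_zero]
    exact le_rfl
  | succ m ih =>
    have hr2 : 0 < r / 2 := by positivity
    have hle : r / 2 ^ (m + 1) ≤ r / 2 := by
      rw [div_le_div_iff_of_pos_left hr (by positivity) two_pos]
      calc (2 : ℝ) = 2 ^ 1 := (pow_one _).symm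
        _ ≤ 2 ^ (m + 1) := pow_le_pow_right₀ (by norm_num) (by omega)
    have heq : r / 2 / 2 ^ m = r / 2 ^ (m + 1) := by rw [div_div, ← pow_succ']
    -- cover the region by two pieces split at `|x| = r/2` (the sphere goes with the outer piece)
    have hcover : ball (0 : V) r \ closedBall 0 (r / 2 ^ (m + 1)) ⊆
        (ball (0 : V) r \ ball 0 (r / 2)) ∪ (ball (0 : V) (r / 2) \ closedBall 0 (r / 2 / 2 ^ m)) := by
      intro x hx
      rw [mem_ball_diff_closedBall_iff] at hx
      simp only [mem_union, mem_ball_diff_closedBall_iff, mem_ball_diff_ball_iff, heq]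
      rcases le_or_gt (r / 2) ‖x‖ with h | h
      · exact Or.inl ⟨h, hx.2⟩
      · exact Or.inr ⟨hx.1, h⟩
    have hdisj : Disjoint (ball (0 : V) r \ ball 0 (r / 2))
        (ball (0 : V) (r / 2) \ closedBall 0 (r / 2 / 2 ^ m)) := by
      rw [Set.disjoint_left]
      intro x hx hx'
      rw [mem_ball_diff_ball_iff] at hx
      rw [mem_ball_diff_closedBall_iff] at hx'
      linarith [hx.1, hx'.2]
    have hsub1 : ball (0 : V) r \ ball 0 (r / 2) ⊆ closedBall 0 (2 * (r / 2)) \ ball 0 (r / 2) := by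
      rw [mul_div_cancel₀ _ (two_ne_zero)]
      exact sdiff_subset_sdiff ball_subset_closedBall subset_rfl
    have hsub2 : ball (0 : V) (r / 2) \ closedBall 0 (r / 2 / 2 ^ m) ⊆ closedBall 0 (r / 2) \ ball 0 (r / 2 / 2 ^ m) :=
      sdiff_subset_sdiff ball_subset_closedBall ball_subset_closedBall
    have hI1 := integrableOn_norm_mul_norm hK hr2 hsub1 (measurableSet_ball.diff measurableSet_ball)
    have hI2 := integrableOn_norm_mul_norm hK (by positivity : 0 < r / 2 / 2 ^ m) hsub2
      (measurableSet_ball.diff measurableSet_closedBall)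
    have hmono : ∫ x in ball (0 : V) r \ closedBall 0 (r / 2 ^ (m + 1)), ‖x‖ * ‖K x‖ ≤
        ∫ x in (ball (0 : V) r \ ball 0 (r / 2)) ∪ (ball (0 : V) (r / 2) \ closedBall 0 (r / 2 / 2 ^ m)),
          ‖x‖ * ‖K x‖ :=
      setIntegral_mono_set (hI1.union hI2) (ae_of_all _ fun x ↦ by positivity) hcover.eventuallyLE
    refine hmono.trans ?_
    rw [setIntegral_union hdisj (measurableSet_ball.diff measurableSet_closedBall) hI1 hI2]
    have hA : ∫ x in ball (0 : V) r \ ball 0 (r / 2), ‖x‖ * ‖K x‖ ≤ A₁ * r := by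
      have hKi : IntegrableOn (fun x ↦ r * ‖K x‖) (closedBall (0 : V) (2 * (r / 2)) \ ball 0 (r / 2)) :=
        (hK _ _ hr2).norm.const_mul r
      calc ∫ x in ball (0 : V) r \ ball 0 (r / 2), ‖x‖ * ‖K x‖
          ≤ ∫ x in ball (0 : V) r \ ball 0 (r / 2), r * ‖K x‖ := by
            refine setIntegral_mono_on (integrableOn_norm_mul_norm hK hr2 hsub1
              (measurableSet_ball.diff measurableSet_ball)) (hKi.mono_set hsub1)
              (measurableSet_ball.diff measurableSet_ball) fun x hx ↦ ?_
            rw [mem_ball_diff_ball_iff] at hx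
            exact mul_le_mul_of_nonneg_right hx.2.le (norm_nonneg _)
        _ ≤ ∫ x in closedBall (0 : V) (2 * (r / 2)) \ ball 0 (r / 2), r * ‖K x‖ :=
            setIntegral_mono_set hKi (ae_of_all _ fun x ↦ by positivity) hsub1.eventuallyLE
        _ = r * ∫ x in closedBall (0 : V) (2 * (r / 2)) \ ball 0 (r / 2), ‖K x‖ := integral_const_mul _ _
        _ ≤ r * A₁ := mul_le_mul_of_nonneg_left (h1 _ hr2) hr.le
        _ = A₁ * r := mul_comm _ _
    have hB := ih hr2
    calc (∫ x in ball (0 : V) r \ ball 0 (r / 2), ‖x‖ * ‖K x‖) +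
          ∫ x in ball (0 : V) (r / 2) \ closedBall 0 (r / 2 / 2 ^ m), ‖x‖ * ‖K x‖
        ≤ A₁ * r + 2 * A₁ * (r / 2) * (1 - (2 ^ m : ℝ)⁻¹) := add_le_add hA hB
      _ = 2 * A₁ * r * (1 - (2 ^ (m + 1) : ℝ)⁻¹) := by rw [pow_succ]; field_simp; ring

/-- `∫_{ε < |x| < r} |x| |K(x)| dx ≤ 2 A₁ r` for `0 < ε`. [cite: Grafakos2014, proof of Thm. 5.4.1] -/
theorem setIntegral_norm_mul_norm_le (hK : ∀ a b, 0 < a → IntegrableOn K (closedBall (0 : V) b \ ball 0 a))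
    (h1 : ∀ R, 0 < R → ∫ x in closedBall (0 : V) (2 * R) \ ball 0 R, ‖K x‖ ≤ A₁) {ε r : ℝ} (hε : 0 < ε)
    (hr : 0 < r) : ∫ x in ball (0 : V) r \ closedBall 0 ε, ‖x‖ * ‖K x‖ ≤ 2 * A₁ * r := by
  have hA₁ : 0 ≤ A₁ := le_trans (integral_nonneg fun _ ↦ norm_nonneg _) (h1 1 one_pos)
  obtain ⟨m, hm⟩ : ∃ m : ℕ, r / 2 ^ m ≤ ε := by
    obtain ⟨m, hm⟩ := pow_unbounded_of_one_lt (r / ε) (by norm_num : (1 : ℝ) < 2)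
    refine ⟨m, ?_⟩
    rw [div_le_iff₀ (by positivity)]
    rw [div_lt_iff₀ hε] at hm
    linarith
  have hsub : ball (0 : V) r \ closedBall 0 ε ⊆ ball (0 : V) r \ closedBall 0 (r / 2 ^ m) :=
    sdiff_subset_sdiff_right (closedBall_subset_closedBall hm)
  calc ∫ x in ball (0 : V) r \ closedBall 0 ε, ‖x‖ * ‖K x‖
      ≤ ∫ x in ball (0 : V) r \ closedBall 0 (r / 2 ^ m), ‖x‖ * ‖K x‖ :=
        setIntegral_mono_set (integrableOn_norm_mul_norm hK (by positivity : 0 < r / 2 ^ m)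
          (sdiff_subset_sdiff ball_subset_closedBall ball_subset_closedBall)
          (measurableSet_ball.diff measurableSet_closedBall)) (ae_of_all _ fun x ↦ by positivity) hsub.eventuallyLE
    _ ≤ 2 * A₁ * r * (1 - (2 ^ m : ℝ)⁻¹) := setIntegral_norm_mul_norm_le_dyadic hK h1 m hr
    _ ≤ 2 * A₁ * r * 1 := by
        refine mul_le_mul_of_nonneg_left ?_ (by positivity)
        linarith [inv_nonneg.2 (pow_nonneg zero_le_two m : (0:ℝ) ≤ 2 ^ m)]
    _ = 2 * A₁ * r := mul_one _


/-- Integrability of `e_ξ K` on open annuli away from the origin. [folklore] -/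
theorem integrableOn_cexp_mul (hK : ∀ a b, 0 < a → IntegrableOn K (closedBall (0 : V) b \ ball 0 a)) (ξ : V)
    {a : ℝ} (ha : 0 < a) {S : Set V} {b : ℝ} (hS : S ⊆ closedBall 0 b \ ball 0 a) :
    IntegrableOn (fun x ↦ cexp (↑(-2 * π * ⟪x, ξ⟫) * I) * K x) S := by
  refine Integrable.bdd_mul (c := 1) ((hK a b ha).mono_set hS) ?_ (ae_of_all _ fun x ↦ ?_)
  · exact (Complex.continuous_exp.comp ((Complex.continuous_ofReal.comp
      ((continuous_const.mul (continuous_id.inner continuous_const)))).mul continuous_const)).aestronglyMeasurable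
  · rw [norm_cexp_neg_two_pi_inner_mul_I]

/-- **Additivity of truncations in the radii**: for `0 < a < b ≤ c`,
`∫_{a<|x|<c} e_ξ K = ∫_{a<|x|<b} e_ξ K + ∫_{b<|x|<c} e_ξ K` (the sphere `|x| = b` is null).
[folklore] -/
theorem setIntegral_annulus_split (hK : ∀ a b, 0 < a → IntegrableOn K (closedBall (0 : V) b \ ball 0 a)) (ξ : V)
    {a b c : ℝ} (ha : 0 < a) (hab : a < b) (hbc : b ≤ c) :
    ∫ x in ball (0 : V) c \ closedBall 0 a, cexp (↑(-2 * π * ⟪x, ξ⟫) * I) * K x =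
      (∫ x in ball (0 : V) b \ closedBall 0 a, cexp (↑(-2 * π * ⟪x, ξ⟫) * I) * K x) +
        ∫ x in ball (0 : V) c \ closedBall 0 b, cexp (↑(-2 * π * ⟪x, ξ⟫) * I) * K x := by
  have hb : 0 < b := ha.trans hab
  have hsplit : ball (0 : V) c \ closedBall 0 a = (ball (0 : V) b \ closedBall 0 a) ∪ (ball (0 : V) c \ ball 0 b) := by
    ext x
    simp only [mem_union, mem_ball_diff_closedBall_iff, mem_ball_diff_ball_iff]
    constructor
    · rintro ⟨h1, h2⟩
      rcases lt_or_ge ‖x‖ b with h | h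
      · exact Or.inl ⟨h1, h⟩
      · exact Or.inr ⟨h, h2⟩
    · rintro (⟨h1, h2⟩ | ⟨h1, h2⟩)
      · exact ⟨h1, lt_of_lt_of_le h2 hbc⟩
      · exact ⟨lt_of_lt_of_le hab h1, h2⟩
  have hdisj : Disjoint (ball (0 : V) b \ closedBall 0 a) (ball (0 : V) c \ ball 0 b) := by
    rw [Set.disjoint_left]
    intro x hx hx'
    rw [mem_ball_diff_closedBall_iff] at hx
    rw [mem_ball_diff_ball_iff] at hx'
    linarith [hx.2, hx'.1]
  rw [hsplit, setIntegral_union hdisj (measurableSet_ball.diff measurableSet_ball)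
    (integrableOn_cexp_mul hK ξ ha (sdiff_subset_sdiff ball_subset_closedBall ball_subset_closedBall))
    (integrableOn_cexp_mul hK ξ hb (sdiff_subset_sdiff ball_subset_closedBall subset_rfl))]
  congr 1
  refine setIntegral_congr_set ?_
  -- `ball c \ ball b` and `ball c \ closedBall b` differ by the null sphere `|x| = b`
  have hs : ball (0 : V) c \ closedBall 0 b = (ball (0 : V) c \ ball 0 b) \ sphere 0 b := by
    rw [← ball_union_sphere, Set.sdiff_sdiff]
  rw [hs]
  exact (sdiff_null_ae_eq_self (Measure.addHaar_sphere_of_ne_zero volume (0 : V) hb.ne')).symm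

/-- **Low-frequency bound**: if `|ξ| b ≤ 1` then `|∫_{a<|x|<b} e^{−2πi x·ξ} K(x) dx| ≤ A₃ + 4π A₁`
(cancellation plus `|e^{−2πi x·ξ} − 1| ≤ 2π|x||ξ|` and the dyadic moment bound).
[cite: Grafakos2014, proof of Thm. 5.4.1, (5.4.6) and Case 2] -/
theorem norm_setIntegral_annulus_le_of_small (hK : ∀ a b, 0 < a → IntegrableOn K (closedBall (0 : V) b \ ball 0 a))
    (h1 : ∀ R, 0 < R → ∫ x in closedBall (0 : V) (2 * R) \ ball 0 R, ‖K x‖ ≤ A₁)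
    (h3 : ∀ a b, 0 < a → a < b → ‖∫ x in ball (0 : V) b \ closedBall 0 a, K x‖ ≤ A₃)
    {a b : ℝ} (ha : 0 < a) (hab : a < b) (hξb : ‖ξ‖ * b ≤ 1) :
    ‖∫ x in ball (0 : V) b \ closedBall 0 a, cexp (↑(-2 * π * ⟪x, ξ⟫) * I) * K x‖ ≤ A₃ + 4 * π * A₁ := by
  have hb : 0 < b := ha.trans hab
  set A := ball (0 : V) b \ closedBall 0 a with hA
  have hAsub : A ⊆ closedBall 0 b \ ball 0 a := sdiff_subset_sdiff ball_subset_closedBall ball_subset_closedBall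
  have hKA : IntegrableOn K A := (hK a b ha).mono_set hAsub
  have hEK : IntegrableOn (fun x ↦ cexp (↑(-2 * π * ⟪x, ξ⟫) * I) * K x) A := integrableOn_cexp_mul hK ξ ha hAsub
  have hsplit : (fun x ↦ cexp (↑(-2 * π * ⟪x, ξ⟫) * I) * K x) =
      fun x ↦ K x + (cexp (↑(-2 * π * ⟪x, ξ⟫) * I) - 1) * K x := by
    funext x; ring
  have hDK : IntegrableOn (fun x ↦ (cexp (↑(-2 * π * ⟪x, ξ⟫) * I) - 1) * K x) A := by
    have : (fun x ↦ (cexp (↑(-2 * π * ⟪x, ξ⟫) * I) - 1) * K x) =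
        fun x ↦ cexp (↑(-2 * π * ⟪x, ξ⟫) * I) * K x - K x := by funext x; ring
    rw [this]
    exact hEK.sub hKA
  rw [hsplit, integral_add hKA hDK]
  refine (norm_add_le _ _).trans (add_le_add (h3 a b ha hab) ?_)
  calc ‖∫ x in A, (cexp (↑(-2 * π * ⟪x, ξ⟫) * I) - 1) * K x‖
      ≤ ∫ x in A, ‖(cexp (↑(-2 * π * ⟪x, ξ⟫) * I) - 1) * K x‖ := norm_integral_le_integral_norm _
    _ ≤ ∫ x in A, 2 * π * ‖ξ‖ * (‖x‖ * ‖K x‖) := by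
        refine integral_mono_of_nonneg (ae_of_all _ fun x ↦ norm_nonneg _)
          ((integrableOn_norm_mul_norm hK ha hAsub (measurableSet_ball.diff measurableSet_closedBall)).const_mul _)
          (ae_of_all _ fun x ↦ ?_)
        simp only [norm_mul]
        calc ‖cexp (↑(-2 * π * ⟪x, ξ⟫) * I) - 1‖ * ‖K x‖ ≤ (2 * π * ‖x‖ * ‖ξ‖) * ‖K x‖ :=
              mul_le_mul_of_nonneg_right (norm_cexp_neg_two_pi_inner_mul_I_sub_one_le x ξ) (norm_nonneg _)
          _ = 2 * π * ‖ξ‖ * (‖x‖ * ‖K x‖) := by ring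
    _ = 2 * π * ‖ξ‖ * ∫ x in A, ‖x‖ * ‖K x‖ := integral_const_mul _ _
    _ ≤ 2 * π * ‖ξ‖ * (2 * A₁ * b) :=
        mul_le_mul_of_nonneg_left (setIntegral_norm_mul_norm_le hK h1 ha hb) (by positivity)
    _ = 4 * π * A₁ * (‖ξ‖ * b) := by ring
    _ ≤ 4 * π * A₁ * 1 := by
        have hA₁ : 0 ≤ A₁ := le_trans (integral_nonneg fun _ ↦ norm_nonneg _) (h1 1 one_pos)
        exact mul_le_mul_of_nonneg_left hξb (by positivity)
    _ = 4 * π * A₁ := mul_one _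

/-- Integrability of a translate `K(· + z)` on a set whose translate lies in a closed shell away from `0`.
[folklore] -/
theorem integrableOn_comp_add_right_of_subset (hK : ∀ a b, 0 < a → IntegrableOn K (closedBall (0 : V) b \ ball 0 a))
    (z : V) {S : Set V} (hSm : MeasurableSet S) {a b : ℝ} (ha : 0 < a)
    (hsub : ∀ x ∈ S, x + z ∈ closedBall (0 : V) b \ ball 0 a) : IntegrableOn (fun x ↦ K (x + z)) S := by
  set S' : Set V := (fun y ↦ y - z) ⁻¹' S with hS'
  have hS'm : MeasurableSet S' := (measurable_id.sub_const z) hSm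
  have hF : Integrable (S'.indicator K) volume := by
    rw [integrable_indicator_iff hS'm]
    refine (hK a b ha).mono_set fun y hy ↦ ?_
    have := hsub (y - z) hy
    rwa [sub_add_cancel] at this
  have hcomp : Integrable (fun x ↦ S'.indicator K (x + z)) volume := hF.comp_add_right z
  rw [← integrable_indicator_iff hSm]
  have hfun : S.indicator (fun x ↦ K (x + z)) = fun x ↦ S'.indicator K (x + z) := by
    funext x
    have hx : x + z ∈ S' ↔ x ∈ S := by simp [hS']
    by_cases h : x ∈ S
    · have h' : x + z ∈ S' := hx.2 h
      simp only [Set.indicator, h, h', if_true]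
    · have h' : x + z ∉ S' := fun h'' ↦ h (hx.1 h'')
      simp only [Set.indicator, h, h', if_false]
  rw [hfun]
  exact hcomp


omit [FiniteDimensional ℝ V] [MeasurableSpace V] [BorelSpace V] in
/-- The half-frequency shift `z = ξ/(2|ξ|²)` has `|z| = 1/(2|ξ|)`. [folklore] -/
theorem norm_halfShift (hξ : ξ ≠ 0) : ‖(2 * ‖ξ‖ ^ 2)⁻¹ • ξ‖ = ‖ξ‖⁻¹ / 2 := by
  have hn : 0 < ‖ξ‖ := norm_pos_iff.2 hξ
  rw [norm_smul, norm_inv, Real.norm_eq_abs, abs_of_pos (by positivity)]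
  field_simp

omit [FiniteDimensional ℝ V] [MeasurableSpace V] [BorelSpace V] in
/-- `e_ξ(x − z) = −e_ξ(x)` for the half-frequency shift `z = ξ/(2|ξ|²)`. [folklore] -/
theorem cexp_sub_halfShift (hξ : ξ ≠ 0) (x : V) :
    cexp (↑(-2 * π * ⟪x - (2 * ‖ξ‖ ^ 2)⁻¹ • ξ, ξ⟫) * I) = -cexp (↑(-2 * π * ⟪x, ξ⟫) * I) := by
  have hn : 0 < ‖ξ‖ := norm_pos_iff.2 hξ
  have hin : ⟪x - (2 * ‖ξ‖ ^ 2)⁻¹ • ξ, ξ⟫ = ⟪x, ξ⟫ - 1 / 2 := by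
    rw [inner_sub_left, real_inner_smul_left, real_inner_self_eq_norm_sq]
    field_simp
  rw [hin]
  have : (↑(-2 * π * (⟪x, ξ⟫ - 1 / 2)) : ℂ) * I = ↑(-2 * π * ⟪x, ξ⟫) * I + π * I := by push_cast; ring
  rw [this, Complex.exp_add, Complex.exp_pi_mul_I]
  ring

/-- **The translation trick** (`I₂` in Grafakos' proof): for `ξ ≠ 0` and `N ≥ |ξ|⁻¹`,
`|∫_{|ξ|⁻¹<|x|<N} e^{−2πi x·ξ} K(x) dx| ≤ A₂/2 + 2A₁`.
[cite: Grafakos2014, proof of Thm. 5.4.1, (5.4.7)–(5.4.12)] -/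
theorem norm_setIntegral_annulus_le_of_inv_norm_le
    (hK : ∀ a b, 0 < a → IntegrableOn K (closedBall (0 : V) b \ ball 0 a))
    (h1 : ∀ R, 0 < R → ∫ x in closedBall (0 : V) (2 * R) \ ball 0 R, ‖K x‖ ≤ A₁)
    (h2 : ∀ y : V, y ≠ 0 → ∀ N : ℝ, ∫ x in closedBall (0 : V) N \ ball 0 (2 * ‖y‖), ‖K (x - y) - K x‖ ≤ A₂)
    (hξ : ξ ≠ 0) {N : ℝ} (hN : ‖ξ‖⁻¹ ≤ N) :
    ‖∫ x in ball (0 : V) N \ closedBall 0 ‖ξ‖⁻¹, cexp (↑(-2 * π * ⟪x, ξ⟫) * I) * K x‖ ≤ A₂ / 2 + 2 * A₁ := by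
  have hn : 0 < ‖ξ‖ := norm_pos_iff.2 hξ
  set r : ℝ := ‖ξ‖⁻¹ with hr
  have hr0 : 0 < r := by positivity
  set z : V := (2 * ‖ξ‖ ^ 2)⁻¹ • ξ with hz
  have hz_norm : ‖z‖ = r / 2 := norm_halfShift hξ
  have hz0 : z ≠ 0 := by
    intro h; rw [h, norm_zero] at hz_norm; linarith
  set e : V → ℂ := fun x ↦ cexp (↑(-2 * π * ⟪x, ξ⟫) * I) with he
  have he1 : ∀ x, ‖e x‖ = 1 := fun x ↦ norm_cexp_neg_two_pi_inner_mul_I x ξ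
  have hez : ∀ x, e (x - z) = -e x := fun x ↦ cexp_sub_halfShift hξ x
  have he_cont : Continuous e := Complex.continuous_exp.comp ((Complex.continuous_ofReal.comp
      ((continuous_const.mul (continuous_id.inner continuous_const)))).mul continuous_const)
  set A : Set V := ball (0 : V) N \ closedBall 0 r with hA
  have hAm : MeasurableSet A := measurableSet_ball.diff measurableSet_closedBall
  have hAsub : A ⊆ closedBall 0 N \ ball 0 r := sdiff_subset_sdiff ball_subset_closedBall ball_subset_closedBall
  set G : V → ℂ := A.indicator K with hG
  have hGi : Integrable G volume := by
    rw [hG, integrable_indicator_iff hAm]; exact (hK r N hr0).mono_set hAsub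
  -- the translated region `{x : x - z ∈ A}` lies in the shell `r/2 ≤ |x| ≤ N + r/2`
  have hshift : ∀ x, x - z ∈ A → x ∈ closedBall (0 : V) (N + r / 2) \ ball 0 (r / 2) := by
    intro x hx
    rw [mem_ball_diff_closedBall_iff] at hx
    rw [mem_closedBall_diff_ball_iff]
    have h1' : ‖x‖ ≤ ‖x - z‖ + ‖z‖ := norm_le_norm_sub_add x z
    have h2' : ‖x - z‖ ≤ ‖x‖ + ‖z‖ := norm_sub_le x z
    constructor <;> linarith
  -- Step 1: the set integral as a whole-space integral
  have hI : ∫ x in A, e x * K x = ∫ x, e x * G x := by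
    rw [← integral_indicator hAm]
    congr 1; funext x
    rw [hG, indicator_mul_right]
  -- Step 2: translation by `z`
  have hF : Integrable (fun x ↦ e x * G x) volume :=
    hGi.bdd_mul (c := 1) he_cont.aestronglyMeasurable (ae_of_all _ fun x ↦ (he1 x).le)
  have hT : ∫ x, e x * G x = -∫ x, e x * G (x - z) := by
    rw [← integral_sub_right_eq_self (fun y ↦ e y * G y) z, ← integral_neg]
    congr 1; funext x
    simp only [hez, neg_mul]
  -- Step 3: `2 I = ∫ e (G - G(· - z))`
  have hF' : Integrable (fun x ↦ e x * G (x - z)) volume := by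
    have h := (hF.comp_sub_right z).neg
    refine h.congr (ae_of_all _ fun x ↦ ?_)
    simp only [Pi.neg_apply, hez, neg_mul, neg_neg]
  have h2I : 2 * ∫ x in A, e x * K x = ∫ x, e x * (G x - G (x - z)) := by
    simp only [mul_sub]
    rw [integral_sub hF hF', hI, two_mul]
    nth_rewrite 2 [hT]
    ring
  -- Step 4: pointwise bound `‖G x - G (x - z)‖ ≤ φ x + ψ x`
  set φ : V → ℝ := fun x ↦ A.indicator (fun _ ↦ (1 : ℝ)) (x - z) * ‖K x - K (x - z)‖ with hφ
  set S₁ : Set V := closedBall (0 : V) (2 * r) \ ball 0 r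
  set S₂ : Set V := closedBall (0 : V) (2 * (N / 2)) \ ball 0 (N / 2)
  set S₃ : Set V := closedBall (0 : V) (2 * (r / 2)) \ ball 0 (r / 2)
  set S₄ : Set V := closedBall (0 : V) (2 * N) \ ball 0 N
  set ψ : V → ℝ := fun x ↦ (S₁.indicator (fun _ ↦ (1 : ℝ)) x + S₂.indicator (fun _ ↦ (1 : ℝ)) x +
    S₃.indicator (fun _ ↦ (1 : ℝ)) x + S₄.indicator (fun _ ↦ (1 : ℝ)) x) * ‖K x‖ with hψ
  have hpt : ∀ x, ‖e x * (G x - G (x - z))‖ ≤ φ x + ψ x := by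
    intro x
    rw [norm_mul, he1, one_mul]
    have hind : ∀ (S : Set V) (y : V), 0 ≤ S.indicator (fun _ ↦ (1 : ℝ)) y := fun S y ↦
      Set.indicator_nonneg (fun _ _ ↦ zero_le_one) _
    by_cases ha : x ∈ A <;> by_cases hb : x - z ∈ A
    · -- both in `A`: only the difference term
      simp only [hG, indicator_of_mem ha, indicator_of_mem hb, hφ, one_mul]
      linarith [hind S₁ x, hind S₂ x, hind S₃ x, hind S₄ x, norm_nonneg (K x),
        show ψ x = _ from rfl, mul_nonneg (add_nonneg (add_nonneg (add_nonneg (hind S₁ x) (hind S₂ x)) (hind S₃ x))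
          (hind S₄ x)) (norm_nonneg (K x))]
    · -- `x ∈ A`, `x - z ∉ A`: `x ∈ S₁ ∪ S₂`
      simp only [hG, indicator_of_mem ha, indicator_of_notMem hb, sub_zero, hφ, zero_mul, zero_add]
      have hxA := ha
      rw [mem_ball_diff_closedBall_iff] at hxA
      have hb' : ‖x - z‖ ≤ r ∨ N ≤ ‖x - z‖ := by
        by_contra hcon; push Not at hcon
        exact hb (mem_ball_diff_closedBall_iff.2 ⟨hcon.1, hcon.2⟩)
      have h1' : ‖x‖ ≤ ‖x - z‖ + ‖z‖ := norm_le_norm_sub_add x z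
      have h2' : ‖x - z‖ ≤ ‖x‖ + ‖z‖ := norm_sub_le x z
      have hmem : x ∈ S₁ ∨ x ∈ S₂ := by
        rcases hb' with h | h
        · left; rw [mem_closedBall_diff_ball_iff]; constructor <;> linarith
        · right; rw [mem_closedBall_diff_ball_iff]; constructor <;> linarith
      have hge : 1 ≤ S₁.indicator (fun _ ↦ (1 : ℝ)) x + S₂.indicator (fun _ ↦ (1 : ℝ)) x +
          S₃.indicator (fun _ ↦ (1 : ℝ)) x + S₄.indicator (fun _ ↦ (1 : ℝ)) x := by
        rcases hmem with h | h
        · rw [indicator_of_mem h]; linarith [hind S₂ x, hind S₃ x, hind S₄ x]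
        · rw [indicator_of_mem h]; linarith [hind S₁ x, hind S₃ x, hind S₄ x]
      calc ‖K x‖ = 1 * ‖K x‖ := (one_mul _).symm
        _ ≤ ψ x := mul_le_mul_of_nonneg_right hge (norm_nonneg _)
    · -- `x ∉ A`, `x - z ∈ A`: `x ∈ S₃ ∪ S₄`
      simp only [hG, indicator_of_notMem ha, indicator_of_mem hb, zero_sub, norm_neg, hφ, one_mul]
      have hxA := hb
      rw [mem_ball_diff_closedBall_iff] at hxA
      have ha' : ‖x‖ ≤ r ∨ N ≤ ‖x‖ := by
        by_contra hcon; push Not at hcon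
        exact ha (mem_ball_diff_closedBall_iff.2 ⟨hcon.1, hcon.2⟩)
      have h1' : ‖x‖ ≤ ‖x - z‖ + ‖z‖ := norm_le_norm_sub_add x z
      have h2' : ‖x - z‖ ≤ ‖x‖ + ‖z‖ := norm_sub_le x z
      have hmem : x ∈ S₃ ∨ x ∈ S₄ := by
        rcases ha' with h | h
        · left; rw [mem_closedBall_diff_ball_iff]; constructor <;> linarith
        · right; rw [mem_closedBall_diff_ball_iff]; constructor <;> linarith
      have hge : 1 ≤ S₁.indicator (fun _ ↦ (1 : ℝ)) x + S₂.indicator (fun _ ↦ (1 : ℝ)) x +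
          S₃.indicator (fun _ ↦ (1 : ℝ)) x + S₄.indicator (fun _ ↦ (1 : ℝ)) x := by
        rcases hmem with h | h
        · rw [indicator_of_mem h]; linarith [hind S₁ x, hind S₂ x, hind S₄ x]
        · rw [indicator_of_mem h]; linarith [hind S₁ x, hind S₂ x, hind S₃ x]
      calc ‖K (x - z)‖ ≤ ‖K x - K (x - z)‖ + ‖K x‖ := by
            calc ‖K (x - z)‖ = ‖K x - (K x - K (x - z))‖ := by rw [sub_sub_cancel]
              _ ≤ ‖K x‖ + ‖K x - K (x - z)‖ := norm_sub_le _ _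
              _ = _ := add_comm _ _
        _ ≤ ‖K x - K (x - z)‖ + ψ x := by
            gcongr
            calc ‖K x‖ = 1 * ‖K x‖ := (one_mul _).symm
              _ ≤ ψ x := mul_le_mul_of_nonneg_right hge (norm_nonneg _)
    · -- neither: zero
      simp only [hG, indicator_of_notMem ha, indicator_of_notMem hb, sub_zero, norm_zero, hφ, zero_mul, zero_add]
      exact mul_nonneg (add_nonneg (add_nonneg (add_nonneg (hind S₁ x) (hind S₂ x)) (hind S₃ x)) (hind S₄ x))
        (norm_nonneg _)
  -- Step 5: `φ` is a translate of `Φ = 1_A ‖K(· + z) − K‖`, whose integral is bounded by `A₂`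
  have hKz : IntegrableOn (fun x ↦ K (x + z)) (closedBall (0 : V) N \ ball 0 r) := by
    refine integrableOn_comp_add_right_of_subset hK z (measurableSet_closedBall.diff measurableSet_ball)
      (a := r / 2) (b := N + r / 2) (by positivity) fun x hx ↦ ?_
    rw [mem_closedBall_diff_ball_iff] at hx ⊢
    have h1' : ‖x‖ ≤ ‖x + z‖ + ‖z‖ := by
      calc ‖x‖ = ‖(x + z) - z‖ := by rw [add_sub_cancel_right]
        _ ≤ ‖x + z‖ + ‖z‖ := norm_sub_le _ _
    have h2' : ‖x + z‖ ≤ ‖x‖ + ‖z‖ := norm_add_le x z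
    constructor <;> linarith
  have hDiff : IntegrableOn (fun y ↦ ‖K (y + z) - K y‖) (closedBall (0 : V) N \ ball 0 r) :=
    (hKz.sub (hK r N hr0)).norm
  set Φ : V → ℝ := A.indicator (fun y ↦ ‖K (y + z) - K y‖) with hΦ
  have hΦi : Integrable Φ volume := by
    rw [hΦ, integrable_indicator_iff hAm]; exact hDiff.mono_set hAsub
  have hφΦ : φ = fun x ↦ Φ (x - z) := by
    funext x
    simp only [hφ, hΦ, Set.indicator, sub_add_cancel]
    split_ifs <;> simp
  have hφi : Integrable φ volume := by rw [hφΦ]; exact hΦi.comp_sub_right z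
  have hφ_int : ∫ x, φ x ≤ A₂ := by
    rw [hφΦ, integral_sub_right_eq_self Φ z, hΦ, integral_indicator hAm]
    calc ∫ y in A, ‖K (y + z) - K y‖ ≤ ∫ y in closedBall (0 : V) N \ ball 0 r, ‖K (y + z) - K y‖ :=
          setIntegral_mono_set hDiff (ae_of_all _ fun _ ↦ norm_nonneg _) hAsub.eventuallyLE
      _ = ∫ y in closedBall (0 : V) N \ ball 0 (2 * ‖-z‖), ‖K (y - -z) - K y‖ := by
          rw [norm_neg, hz_norm, mul_div_cancel₀ _ two_ne_zero]
          simp only [sub_neg_eq_add]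
      _ ≤ A₂ := h2 (-z) (neg_ne_zero.2 hz0) N
  -- Step 6: `ψ` is a sum of four shell pieces, each with integral at most `A₁`
  have hNpos : 0 < N := lt_of_lt_of_le hr0 hN
  have hSi : ∀ {R : ℝ}, 0 < R →
      Integrable (fun x ↦ (closedBall (0 : V) (2 * R) \ ball 0 R).indicator (fun _ ↦ (1 : ℝ)) x * ‖K x‖) volume ∧
      ∫ x, (closedBall (0 : V) (2 * R) \ ball 0 R).indicator (fun _ ↦ (1 : ℝ)) x * ‖K x‖ ≤ A₁ := by
    intro R hR
    have heq : (fun x ↦ (closedBall (0 : V) (2 * R) \ ball 0 R).indicator (fun _ ↦ (1 : ℝ)) x * ‖K x‖) =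
        (closedBall (0 : V) (2 * R) \ ball 0 R).indicator (fun x ↦ ‖K x‖) := by
      funext x; simp only [Set.indicator]; split_ifs <;> simp
    rw [heq, integrable_indicator_iff (measurableSet_closedBall.diff measurableSet_ball),
      integral_indicator (measurableSet_closedBall.diff measurableSet_ball)]
    exact ⟨(hK R _ hR).norm, h1 R hR⟩
  obtain ⟨hS1i, hS1⟩ := hSi hr0
  obtain ⟨hS2i, hS2⟩ := hSi (half_pos hNpos)
  obtain ⟨hS3i, hS3⟩ := hSi (half_pos hr0)
  obtain ⟨hS4i, hS4⟩ := hSi hNpos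
  have h12 : Integrable (fun x ↦ S₁.indicator (fun _ ↦ (1 : ℝ)) x * ‖K x‖ +
      S₂.indicator (fun _ ↦ (1 : ℝ)) x * ‖K x‖) volume := hS1i.add hS2i
  have h123 : Integrable (fun x ↦ S₁.indicator (fun _ ↦ (1 : ℝ)) x * ‖K x‖ +
      S₂.indicator (fun _ ↦ (1 : ℝ)) x * ‖K x‖ + S₃.indicator (fun _ ↦ (1 : ℝ)) x * ‖K x‖) volume := h12.add hS3i
  have h1234 : Integrable (fun x ↦ S₁.indicator (fun _ ↦ (1 : ℝ)) x * ‖K x‖ +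
      S₂.indicator (fun _ ↦ (1 : ℝ)) x * ‖K x‖ + S₃.indicator (fun _ ↦ (1 : ℝ)) x * ‖K x‖ +
      S₄.indicator (fun _ ↦ (1 : ℝ)) x * ‖K x‖) volume := h123.add hS4i
  have hψeq : ∀ x, ψ x = S₁.indicator (fun _ ↦ (1 : ℝ)) x * ‖K x‖ + S₂.indicator (fun _ ↦ (1 : ℝ)) x * ‖K x‖ +
      S₃.indicator (fun _ ↦ (1 : ℝ)) x * ‖K x‖ + S₄.indicator (fun _ ↦ (1 : ℝ)) x * ‖K x‖ := by
    intro x; simp only [hψ]; ring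
  have hψi : Integrable ψ volume := h1234.congr (ae_of_all _ fun x ↦ (hψeq x).symm)
  have hψ_int : ∫ x, ψ x ≤ 4 * A₁ := by
    calc ∫ x, ψ x = ∫ x, (S₁.indicator (fun _ ↦ (1 : ℝ)) x * ‖K x‖ + S₂.indicator (fun _ ↦ (1 : ℝ)) x * ‖K x‖ +
          S₃.indicator (fun _ ↦ (1 : ℝ)) x * ‖K x‖ + S₄.indicator (fun _ ↦ (1 : ℝ)) x * ‖K x‖) :=
          integral_congr_ae (ae_of_all _ hψeq)
      _ = (∫ x, (S₁.indicator (fun _ ↦ (1 : ℝ)) x * ‖K x‖ + S₂.indicator (fun _ ↦ (1 : ℝ)) x * ‖K x‖ +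
          S₃.indicator (fun _ ↦ (1 : ℝ)) x * ‖K x‖)) + ∫ x, S₄.indicator (fun _ ↦ (1 : ℝ)) x * ‖K x‖ :=
          integral_add h123 hS4i
      _ = (∫ x, (S₁.indicator (fun _ ↦ (1 : ℝ)) x * ‖K x‖ + S₂.indicator (fun _ ↦ (1 : ℝ)) x * ‖K x‖)) +
          (∫ x, S₃.indicator (fun _ ↦ (1 : ℝ)) x * ‖K x‖) + ∫ x, S₄.indicator (fun _ ↦ (1 : ℝ)) x * ‖K x‖ := by
          rw [integral_add h12 hS3i]
      _ = (∫ x, S₁.indicator (fun _ ↦ (1 : ℝ)) x * ‖K x‖) + (∫ x, S₂.indicator (fun _ ↦ (1 : ℝ)) x * ‖K x‖) +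
          (∫ x, S₃.indicator (fun _ ↦ (1 : ℝ)) x * ‖K x‖) + ∫ x, S₄.indicator (fun _ ↦ (1 : ℝ)) x * ‖K x‖ := by
          rw [integral_add hS1i hS2i]
      _ ≤ A₁ + A₁ + A₁ + A₁ := by gcongr
      _ = 4 * A₁ := by ring
  -- Step 7: conclude
  have h2norm : ‖2 * ∫ x in A, e x * K x‖ ≤ A₂ + 4 * A₁ := by
    rw [h2I]
    calc ‖∫ x, e x * (G x - G (x - z))‖ ≤ ∫ x, φ x + ψ x :=
          norm_integral_le_of_norm_le (hφi.add hψi) (ae_of_all _ hpt)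
      _ = (∫ x, φ x) + ∫ x, ψ x := integral_add hφi hψi
      _ ≤ A₂ + 4 * A₁ := add_le_add hφ_int hψ_int
  rw [norm_mul, Complex.norm_two] at h2norm
  linarith


/-- **Grafakos, Classical Fourier Analysis, Thm. 5.4.1 ((5.4.4))**: under the size condition (5.4.1)
`∫_{R≤|x|≤2R} |K| ≤ A₁`, Hörmander's condition (5.4.2) `∫_{|x| ≥ 2|y|} |K(x−y) − K(x)| dx ≤ A₂` (here on every
bounded part of that region) and the cancellation condition (5.4.3) `|∫_{R₁<|x|<R₂} K| ≤ A₃`, the Fourier transform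
of every doubly truncated kernel is bounded: `|∫_{ε<|x|<N} K(x) e^{−2πi x·ξ} dx| ≤ 15 (A₁ + A₂ + A₃)` for all
`0 < ε < N` and all `ξ`. [cite: Grafakos2014, Thm. 5.4.1] -/
theorem norm_setIntegral_annulus_cexp_mul_le [Nontrivial V]
    (hK : ∀ a b, 0 < a → IntegrableOn K (closedBall (0 : V) b \ ball 0 a))
    (h1 : ∀ R, 0 < R → ∫ x in closedBall (0 : V) (2 * R) \ ball 0 R, ‖K x‖ ≤ A₁)
    (h2 : ∀ y : V, y ≠ 0 → ∀ N : ℝ, ∫ x in closedBall (0 : V) N \ ball 0 (2 * ‖y‖), ‖K (x - y) - K x‖ ≤ A₂)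
    (h3 : ∀ a b, 0 < a → a < b → ‖∫ x in ball (0 : V) b \ closedBall 0 a, K x‖ ≤ A₃)
    {ε N : ℝ} (hε : 0 < ε) (hεN : ε < N) (ξ : V) :
    ‖∫ x in ball (0 : V) N \ closedBall 0 ε, cexp (↑(-2 * π * ⟪x, ξ⟫) * I) * K x‖ ≤ 15 * (A₁ + A₂ + A₃) := by
  -- the constants are nonnegative
  have hA₁ : 0 ≤ A₁ := le_trans (integral_nonneg fun _ ↦ norm_nonneg _) (h1 1 one_pos)
  have hA₂ : 0 ≤ A₂ := by
    obtain ⟨y, hy⟩ := exists_ne (0 : V)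
    exact le_trans (integral_nonneg fun _ ↦ norm_nonneg _) (h2 y hy 0)
  have hA₃ : 0 ≤ A₃ := le_trans (norm_nonneg _) (h3 1 2 one_pos one_lt_two)
  have hπ : π ≤ 13 / 4 := by linarith [Real.pi_lt_d2]
  have hN : 0 < N := hε.trans hεN
  by_cases hsmall : ‖ξ‖ * N ≤ 1
  · -- low frequencies (this includes `ξ = 0`)
    calc ‖∫ x in ball (0 : V) N \ closedBall 0 ε, cexp (↑(-2 * π * ⟪x, ξ⟫) * I) * K x‖ ≤ A₃ + 4 * π * A₁ :=
          norm_setIntegral_annulus_le_of_small hK h1 h3 hε hεN hsmall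
      _ ≤ 15 * (A₁ + A₂ + A₃) := by nlinarith
  · have hξ : ξ ≠ 0 := by
      intro h; rw [h, norm_zero, zero_mul] at hsmall; exact hsmall zero_le_one
    have hn : 0 < ‖ξ‖ := norm_pos_iff.2 hξ
    set r : ℝ := ‖ξ‖⁻¹ with hr
    have hr0 : 0 < r := by positivity
    have hrN : r < N := by
      rw [not_le] at hsmall
      rw [hr, inv_lt_iff_one_lt_mul₀ hn, mul_comm]
      exact hsmall
    have hξr : ‖ξ‖ * r ≤ 1 := by rw [hr, mul_inv_cancel₀ hn.ne']
    rcases lt_or_ge ε r with hεr | hrε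
    · -- `ε < |ξ|⁻¹ < N`: split at `|ξ|⁻¹`
      rw [setIntegral_annulus_split hK ξ hε hεr hrN.le]
      calc ‖(∫ x in ball (0 : V) r \ closedBall 0 ε, cexp (↑(-2 * π * ⟪x, ξ⟫) * I) * K x) +
            ∫ x in ball (0 : V) N \ closedBall 0 r, cexp (↑(-2 * π * ⟪x, ξ⟫) * I) * K x‖
          ≤ (A₃ + 4 * π * A₁) + (A₂ / 2 + 2 * A₁) :=
            norm_add_le_of_le (norm_setIntegral_annulus_le_of_small hK h1 h3 hε hεr hξr)
              (norm_setIntegral_annulus_le_of_inv_norm_le hK h1 h2 hξ hrN.le)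
        _ ≤ 15 * (A₁ + A₂ + A₃) := by nlinarith
    · rcases hrε.lt_or_eq with hrε' | hre
      · -- `|ξ|⁻¹ < ε < N`: difference of two `I₂`-type integrals
        have hsplit := setIntegral_annulus_split hK ξ hr0 hrε' hεN.le
        have heq : ∫ x in ball (0 : V) N \ closedBall 0 ε, cexp (↑(-2 * π * ⟪x, ξ⟫) * I) * K x =
            (∫ x in ball (0 : V) N \ closedBall 0 r, cexp (↑(-2 * π * ⟪x, ξ⟫) * I) * K x) -
              ∫ x in ball (0 : V) ε \ closedBall 0 r, cexp (↑(-2 * π * ⟪x, ξ⟫) * I) * K x := by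
          rw [hsplit]; ring
        rw [heq]
        calc ‖(∫ x in ball (0 : V) N \ closedBall 0 r, cexp (↑(-2 * π * ⟪x, ξ⟫) * I) * K x) -
              ∫ x in ball (0 : V) ε \ closedBall 0 r, cexp (↑(-2 * π * ⟪x, ξ⟫) * I) * K x‖
            ≤ (A₂ / 2 + 2 * A₁) + (A₂ / 2 + 2 * A₁) :=
              norm_sub_le_of_le (norm_setIntegral_annulus_le_of_inv_norm_le hK h1 h2 hξ hrN.le)
                (norm_setIntegral_annulus_le_of_inv_norm_le hK h1 h2 hξ hrε)
          _ ≤ 15 * (A₁ + A₂ + A₃) := by nlinarith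
      · -- `ε = |ξ|⁻¹`
        rw [← hre]
        calc ‖∫ x in ball (0 : V) N \ closedBall 0 r, cexp (↑(-2 * π * ⟪x, ξ⟫) * I) * K x‖ ≤ A₂ / 2 + 2 * A₁ :=
              norm_setIntegral_annulus_le_of_inv_norm_le hK h1 h2 hξ hrN.le
          _ ≤ 15 * (A₁ + A₂ + A₃) := by nlinarith

/-- **Grafakos CFA Thm. 5.4.1 in Fourier-transform form**: `|𝓕(K 𝟙_{ε<|·|<N})(ξ)| ≤ 15(A₁ + A₂ + A₃)`.
[cite: Grafakos2014, Thm. 5.4.1, (5.4.4)] -/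
theorem norm_fourier_indicator_annulus_le [Nontrivial V]
    (hK : ∀ a b, 0 < a → IntegrableOn K (closedBall (0 : V) b \ ball 0 a))
    (h1 : ∀ R, 0 < R → ∫ x in closedBall (0 : V) (2 * R) \ ball 0 R, ‖K x‖ ≤ A₁)
    (h2 : ∀ y : V, y ≠ 0 → ∀ N : ℝ, ∫ x in closedBall (0 : V) N \ ball 0 (2 * ‖y‖), ‖K (x - y) - K x‖ ≤ A₂)
    (h3 : ∀ a b, 0 < a → a < b → ‖∫ x in ball (0 : V) b \ closedBall 0 a, K x‖ ≤ A₃)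
    {ε N : ℝ} (hε : 0 < ε) (hεN : ε < N) (ξ : V) :
    ‖𝓕 ((ball (0 : V) N \ closedBall 0 ε).indicator K) ξ‖ ≤ 15 * (A₁ + A₂ + A₃) := by
  rw [Real.fourier_eq']
  have heq : ∫ v, cexp (↑(-2 * π * ⟪v, ξ⟫) * I) • (ball (0 : V) N \ closedBall 0 ε).indicator K v =
      ∫ x in ball (0 : V) N \ closedBall 0 ε, cexp (↑(-2 * π * ⟪x, ξ⟫) * I) * K x := by
    rw [← integral_indicator (measurableSet_ball.diff measurableSet_closedBall)]
    congr 1; funext x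
    rw [smul_eq_mul, indicator_mul_right]
  rw [heq]
  exact norm_setIntegral_annulus_cexp_mul_le hK h1 h2 h3 hε hεN ξ

end TruncatedKernel

end Literature.Analysis.SingularIntegrals

end
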